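import Summits.NavierStokesRegularity.NavierStokesRegularity.Theses.PumpContinuation
import Literature.Analysis.FluidPDE.SelfSimilar
import Literature.Analysis.FluidPDE.BlowupAncientSolution

/-!
# Sketch (crux-ideate r1, ideator k = 2) for `BoundedTemperatureClosed` (stmt-NavierStokesRegularity-18303)

First lemmas of the two idea cards `recycle-and-rigidify` and `closed-shadow-tuned-ignition`,
plus the common PROVED reduction `closed_of_lossy_of_attain` (closedness ⇐ lossy closedness +
attainment-in-`M`), over existing declarations only. Sorry-free; the hard statements are `def … :
Prop` shapes, not assertions.
-/

noncomputable section

open MeasureTheory Set Filter Topology Function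
open Literature.Analysis.FluidPDE Literature.Analysis.FluidPDE.Tao2016

set_option linter.dupNamespace false

namespace Summit.NavierStokesRegularity.NavierStokesRegularity.Cruxes.BoundedTemperatureClosed.IdeasK2

/-! ### The pieces of the crux (verbatim the Disproof's `segForm` / `btSet`, copied because the
`Cruxes` module is not part of the farm build) -/

/-- The segment of trilinear forms `T_θ = (1-θ)·B̃_𝒜 + θ·B`. -/
def segForm (𝒜 : AveragingDatum) (θ : ℝ) : L2C → L2C → L2C → ℂ :=
  fun a b c => ((1 - θ : ℝ) : ℂ) * 𝒜.form a b c + ((θ : ℝ) : ℂ) * eulerForm a b c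

/-- The bounded-temperature blow-up set of a `θ`-family of forms at ceiling `M` (body of the crux). -/
def btSet (T : ℝ → L2C → L2C → L2C → ℂ) (M : ℝ) : Set ℝ :=
  {θ : ℝ | θ ∈ Icc (0 : ℝ) 1 ∧
    ∃ u₀ : SchwartzMap (EuclideanSpace ℝ (Fin 3)) (EuclideanSpace ℝ (Fin 3)),
      VectorCalculus.IsDivFree ⇑u₀ ∧ ∃ S : ℝ, 0 < S ∧ ∃ u : ℝ → L2C,
        IsMildSolutionFor (T θ) (schwartzL2 u₀) (Ico 0 S) u ∧
        (∀ t ∈ Ico 0 S, eLpNorm (u t) ⊤ volume ≤ ENNReal.ofReal (M / Real.sqrt (S - t))) ∧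
        ¬ ∃ S' : ℝ, S < S' ∧ ∃ v : ℝ → L2C,
          IsMildSolutionFor (T θ) (schwartzL2 u₀) (Ico 0 S') v ∧ ∀ t ∈ Ico 0 S, v t = u t}

/-- The crux read through `btSet`/`segForm` (definitional). -/
theorem crux_iff :
    Theses.PumpContinuation.BoundedTemperatureClosed ↔
      ∀ 𝒜 : AveragingDatum, 𝒜.IsSymmetric → 𝒜.HasCancellation →
        ∀ M : ℝ, IsClosed (btSet (segForm 𝒜) M) :=
  Iff.rfl

/-- Monotonicity in the ceiling: an `M`-witness is an `M'`-witness for `M ≤ M'`. -/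
theorem btSet_mono (T : ℝ → L2C → L2C → L2C → ℂ) {M M' : ℝ} (h : M ≤ M') :
    btSet T M ⊆ btSet T M' := by
  rintro θ ⟨hθ, u₀, hdiv, S, hS, u, hmild, hrate, hnoext⟩
  refine ⟨hθ, u₀, hdiv, S, hS, u, hmild, fun t ht => (hrate t ht).trans ?_, hnoext⟩
  exact ENNReal.ofReal_le_ofReal (div_le_div_of_nonneg_right h (Real.sqrt_nonneg _))

/-! ### Common reduction (analysis A of the cards): closed ⇐ LOSSY + ATTAIN -/

/-- **Lossy closedness**: limits of `M`-witness parameters are `(M+η)`-witness parameters for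
every `η > 0` (the compactness half; the zero datum `T_θ = θB` satisfies it trivially). -/
def LossyClosed : Prop :=
  ∀ 𝒜 : AveragingDatum, 𝒜.IsSymmetric → 𝒜.HasCancellation →
    ∀ M η : ℝ, 0 < η → closure (btSet (segForm 𝒜) M) ⊆ btSet (segForm 𝒜) (M + η)

/-- **Attainment in the ceiling at a fixed operator**: a parameter carrying `(M+η)`-witnesses for
every `η > 0` carries an `M`-witness (for the zero datum this is attainment of the infimal
Schwartz-data Type-I constant of Navier–Stokes — Disproof (b); necessary for the crux there). -/
def Attain : Prop :=
  ∀ 𝒜 : AveragingDatum, 𝒜.IsSymmetric → 𝒜.HasCancellation →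
    ∀ M θ : ℝ, (∀ η : ℝ, 0 < η → θ ∈ btSet (segForm 𝒜) (M + η)) → θ ∈ btSet (segForm 𝒜) M

/-- **PROVED reduction.** `LossyClosed → Attain → BoundedTemperatureClosed`
(`closure S_M ⊆ ⋂_η S_{M+η} ⊆ S_M`). Both cards prove `LossyClosed`; `Attain` is the declared
residual common to every line (it contains an open Navier–Stokes statement at the zero datum). -/
theorem closed_of_lossy_of_attain (hL : LossyClosed) (hA : Attain) :
    Theses.PumpContinuation.BoundedTemperatureClosed := by
  intro 𝒜 hs hc M
  refine isClosed_of_closure_subset fun θ hθ => ?_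
  exact hA 𝒜 hs hc M θ fun η hη => hL 𝒜 hs hc M η hη hθ

/-! ### Card 1 `recycle-and-rigidify`: first lemma and the rigidity shape -/

/-- **Datum recycling tracks the witness up to every pre-singular time** (first lemma of card 1;
continuous dependence on the operator parameter for a FIXED witness, size M, provable from the
uniform-in-`θ` `H¹⁰` local theory of the segment forms): given a cancelling datum, an `M`-witness
`(u₀, S, u)` of `T_{θ'}` and a time `S₁ < S`, for every `η > 0` there is `δ > 0` such that for
`|θ - θ'| < δ` the `T_θ`-solution from the SAME Schwartz datum exists on `[0, S₁]` and stays
within `η/√(S-t)` of `u` in `L^∞`; in particular it obeys the Type-I bound with ceiling `M + η`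
relative to `S` on `[0, S₁]`. -/
def RecyclingTracksLocally : Prop :=
  ∀ 𝒜 : AveragingDatum, 𝒜.HasCancellation →
    ∀ (M η S₁ θ' S : ℝ) (u₀ : SchwartzMap (EuclideanSpace ℝ (Fin 3)) (EuclideanSpace ℝ (Fin 3)))
      (u : ℝ → L2C), 0 < η → S₁ < S → VectorCalculus.IsDivFree ⇑u₀ →
      IsMildSolutionFor (segForm 𝒜 θ') (schwartzL2 u₀) (Ico 0 S) u →
      (∀ t ∈ Ico 0 S, eLpNorm (u t) ⊤ volume ≤ ENNReal.ofReal (M / Real.sqrt (S - t))) →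
      ∃ δ : ℝ, 0 < δ ∧ ∀ θ : ℝ, |θ - θ'| < δ →
        ∃ w : ℝ → L2C, IsMildSolutionFor (segForm 𝒜 θ) (schwartzL2 u₀) (Icc 0 S₁) w ∧
          ∀ t ∈ Icc 0 S₁, eLpNorm (w t - u t) ⊤ volume ≤ ENNReal.ofReal (η / Real.sqrt (S - t))

/-- Local notation for physical space. -/
local notation "ℝ³" => EuclideanSpace ℝ (Fin 3)

/-- **Heteroclinic rigidity at the Euler end** (card 1's hard stub, θ = 1 instance, over KNSS
vocabulary): if an ancient mild Navier–Stokes solution `W` with Type-I time decay EMANATES from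
another one `U` — some blow-DOWN sequence `c_k → 0⁺` of `W` converges to `U` locally uniformly on
`(-∞,0) × ℝ³` — then `W` is a symmetry image of `U` (space–time translation and scaling): the
unstable set of a bounded-temperature ancient profile consists of its symmetry orbit only
("Type-I blow-up at bounded temperature is codimension-0 stable", Merle–Zaag Liouville ↦ NS). -/
def HeteroclinicRigidityNS : Prop :=
  ∀ (M : ℝ) (U W : ℝ → ℝ³ → ℝ³),
    IsAncientMildSolution 1 U → IsAncientMildSolution 1 W →
    ContDiffOn ℝ (⊤ : ℕ∞) (uncurry U) (Iio 0 ×ˢ univ) → ContDiffOn ℝ (⊤ : ℕ∞) (uncurry W) (Iio 0 ×ˢ univ) →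
    HasTypeITimeDecay M U → HasTypeITimeDecay M W → (¬ ∀ t < 0, ∀ x, U t x = 0) →
    (∃ c : ℕ → ℝ, (∀ k, 0 < c k) ∧ Tendsto c atTop (𝓝 0) ∧
      ∀ K : Set (ℝ × ℝ³), IsCompact K → K ⊆ Iio 0 ×ˢ univ →
        TendstoUniformlyOn (fun k z => nsRescale (c k) W z.1 z.2) (uncurry U) atTop K) →
    ∃ (a : ℝ³) (τ γ : ℝ), 0 < γ ∧ ∀ t : ℝ, ∀ x : ℝ³, γ ^ 2 * t + τ < 0 →
      W t x = γ • U (γ ^ 2 * t + τ) (γ • x + a)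

/-! ### Card 2 `closed-shadow-tuned-ignition`: the free topological core and the ignition shape -/

/-- **Closed-shadow core (PROVED, pure topology).** If the graph `G ⊆ ℝ × X` of a parametrised
family of objects in a compact space `X` is closed, then the set of parameters carrying an object
is closed. Used with `X` = a weak-* compact ball of bounded-temperature eternal similarity
trajectories and `G` = {(θ, U) : U is a nontrivial bounded-temperature trajectory of the
`T_θ`-semiflow} (closed by parabolic compactness + the ε-regularity temperature floor). -/
theorem isClosed_params_of_isClosed_graph {X : Type*} [TopologicalSpace X] [CompactSpace X]
    {G : Set (ℝ × X)} (hG : IsClosed G) : IsClosed (Prod.fst '' G) :=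
  isClosedMap_fst_of_compactSpace G hG

/-- **Ignition of a bounded-temperature ancient profile from Schwartz data, with `η` loss**
(card 2's hard stub at θ = 1, over KNSS + Tao vocabulary): every nontrivial smooth ancient mild
Navier–Stokes solution with Type-I time decay `M` can be re-ignited — for every `η > 0` some
Schwartz divergence-free datum launches an `H¹⁰_df`-mild solution of the true Navier–Stokes form
with the Type-I bound of ceiling `M + η` and no mild extension (finite-codimension tuning onto
the centre-stable set of the profile after far-field truncation; CRS 2019 Thm 1.2 ↦ NS). -/
def IgnitionWithLossNS : Prop :=
  ∀ (M : ℝ) (U : ℝ → ℝ³ → ℝ³), IsAncientMildSolution 1 U →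
    ContDiffOn ℝ (⊤ : ℕ∞) (uncurry U) (Iio 0 ×ˢ univ) → HasTypeITimeDecay M U →
    (¬ ∀ t < 0, ∀ x, U t x = 0) → ∀ η : ℝ, 0 < η →
    ∃ u₀ : SchwartzMap ℝ³ ℝ³, VectorCalculus.IsDivFree ⇑u₀ ∧ ∃ S : ℝ, 0 < S ∧ ∃ u : ℝ → L2C,
      IsMildSolutionFor eulerForm (schwartzL2 u₀) (Ico 0 S) u ∧
      (∀ t ∈ Ico 0 S, eLpNorm (u t) ⊤ volume ≤ ENNReal.ofReal ((M + η) / Real.sqrt (S - t))) ∧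
      ¬ ∃ S' : ℝ, S < S' ∧ ∃ v : ℝ → L2C,
        IsMildSolutionFor eulerForm (schwartzL2 u₀) (Ico 0 S') v ∧ ∀ t ∈ Ico 0 S, v t = u t

/-- Sanity link (PROVED): ignition with loss at the Euler end puts `1` into the
`(M+η)`-blow-up set of EVERY segment, since `T_1 = B` (`segForm 𝒜 1 = eulerForm`). -/
theorem segForm_one (𝒜 : AveragingDatum) : segForm 𝒜 1 = eulerForm := by
  funext a b c; simp [segForm]

theorem one_mem_btSet_of_ignition (hI : IgnitionWithLossNS) (𝒜 : AveragingDatum) {M : ℝ}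
    {U : ℝ → ℝ³ → ℝ³} (hU : IsAncientMildSolution 1 U)
    (hsm : ContDiffOn ℝ (⊤ : ℕ∞) (uncurry U) (Iio 0 ×ˢ univ)) (hdec : HasTypeITimeDecay M U)
    (hne : ¬ ∀ t < 0, ∀ x, U t x = 0) {η : ℝ} (hη : 0 < η) :
    (1 : ℝ) ∈ btSet (segForm 𝒜) (M + η) := by
  obtain ⟨u₀, hdiv, S, hS, u, hmild, hrate, hnoext⟩ := hI M U hU hsm hdec hne η hη
  refine ⟨⟨zero_le_one, le_rfl⟩, u₀, hdiv, S, hS, u, ?_, hrate, ?_⟩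
  · simpa only [segForm_one] using hmild
  · simpa only [segForm_one] using hnoext

end Summit.NavierStokesRegularity.NavierStokesRegularity.Cruxes.BoundedTemperatureClosed.IdeasK2
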